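import Literature.MathematicalPhysics.KineticTheory.PureQuarticKernelIdentification
import Literature.MathematicalPhysics.KineticTheory.PureQuarticEnergyScale
import Literature.MathematicalPhysics.KineticTheory.LangevinChainH2Proof
import HarnessLib

/-!
# CEHR Theorem 5.1 / Remark 5.2 (the Lyapunov condition H2) for the purely quartic chain at EVERY `t* > 0`, with a compact exceptional set

Topic `Literature/MathematicalPhysics/KineticTheory` (trunk T-KINETIC). Companion proof file
(seat B) of the provefact unit for `CuneoEckmannHairerReyBellet2018_thm213_pureQuartic`
(`PureQuarticChainNESS.lean`, discharged in `PureQuarticThm213Holds.lean`): Cuneo–Eckmann–Hairer–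
Rey-Bellet, *Non-equilibrium steady states for networks of oscillators*, Electron. J. Probab. **23**
(2018) no. 55 (arXiv:1712.09413), Theorem 5.1 with Remark 5.2 for
`pureQuarticChain μ γ = ⟨U = μq⁴/4, V = r⁴/4, γ⟩`, `μ, γ > 0`, `N ≥ 1`, `T_L, T_R > 0`, in the FULL
printed form — every `t* > 0`, `E_z e^{θH(z_{t*})} ≤ κ e^{θH(z)} + c 1_K(z)` with a compact `K` —
for the chain pipeline's kernels `OscillatorChain.transitionKernel` and, transported, for the
model-free `OscillatorChain.langevinKernel` (the sibling unit's `pureQuarticChain_H2` in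
`PureQuarticChainNESSProofs.lean` is the case `t* = 1` without the indicator).

## Part 1 — the Lyapunov condition H2 (CEHR Theorem 5.1 / Remark 5.2) for the purely quartic chain

The Lyapunov condition H2 for `V = e^{θH}` for the transition kernels
`OscillatorChain.transitionKernel` of the purely quartic chain: the probabilistic shell
`LangevinChainH2.lean` (Remark 5.2 from a uniform decay; the reduction to one short window by
Chapman–Kolmogorov and (3.4); the window estimate from a pathwise energy drop by Hölder and (3.4))
and the discharge `LangevinChainH2Proof.lean` (written in the tree for `pinnedChain ω₂ lam β γ`),
RE-INSTANTIATED for the purely quartic chain on top of the pathwise layer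
`PureQuarticEnergyScale.lean`. Since the purely quartic Hamiltonian is exactly homogeneous, every
high-energy point is in the interaction regime of CEHR §5.1
(`pureQuartic_limitChain_hamiltonian_ge_half`); the pinning regime of §5.2 does not occur.

* `pureQuarticChain_transitionKernel_H2_of_decay`, `pureQuarticChain_transitionKernel_decay_of_window`,
  `pureQuarticChain_transitionKernel_window_decay_of_pathwise`, `pureQuarticChain_transitionKernel_window_decay_of_dissipation` —
  the shell;
* `pureQuarticChain_transitionKernel_H2` — **Theorem 5.1 / Remark 5.2 for the purely quartic chain**: for every
  `0 < θ < 1/max(T_L,T_R)` and `t* > 0` there are `κ ∈ (0,1)`, `c > 0` and a compact `K` with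
  `E_z e^{θH(z_{t*})} ≤ κ e^{θH(z)} + c 1_K(z)` for all `z`.

## Part 2 — transport to the model-free kernels

* `pureQuarticChain_langevinKernel_H2` — H2 at every `t*` for `langevinKernel`
  (`pureQuarticChain_langevinKernel_eq_transitionKernel`).

## References

* N. Cuneo, J.-P. Eckmann, M. Hairer, L. Rey-Bellet, EJP **23** (2018) no. 55 (arXiv:1712.09413),
  Thm 2.13, Thm 3.1, §3 eq. (3.4), Props. 3.2–3.8, Prop. 4.1, §5 Thm 5.1, Rem 5.2, Prop 5.3,
  Cor 5.4, Lemma 5.5, Rem 5.7, §5.1. Page numbers refer to the arXiv version.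
* P. Carmona, Stoch. Proc. Appl. 117 (2007) 1076–1092 (the decay `E e^{θH(z_{t*})-θH(z₀)} → 0`).
-/

noncomputable section

open MeasureTheory ProbabilityTheory Filter Topology Set Metric
open scoped NNReal ENNReal

namespace Literature.MathematicalPhysics.KineticTheory.HeatConduction

/-! ## Part 1: the Lyapunov condition H2 -/

open Literature.Probability.Process OscillatorChain

variable {N : ℕ}

section Assembly

variable {μ γ : ℝ} {N : ℕ} {T_L T_R : ℝ}
variable (hμ : 0 < μ) (hγ : 0 < γ) (hN : 0 < N) (hTL : 0 < T_L)
  (hTR : 0 < T_R)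
include hμ hγ hN hTL hTR

/-- **Remark 5.2 of CEHR for the constructed kernels**: a uniform decay
`P_{t*} e^{θH}(z) ≤ e^{θH(z)}/2` above the energy `E₁` gives the Lyapunov condition H2 with
`κ = 1/2`, the compact `K = {H ≤ E₁}` and `c = e^{θγ(T_L+T_R)t*} e^{θE₁}` (on `K` the a-priori
bound (3.4) `P_t e^{θH} ≤ e^{θγ(T_L+T_R)t} e^{θH}` applies).
[cite: CuneoEckmannHairerReyBellet2018, Rem 5.2] -/
theorem pureQuarticChain_transitionKernel_H2_of_decay {θ : ℝ} (hθ : 0 < θ) (hθ' : θ < 1 / max T_L T_R) (tstar : ℝ≥0)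
    {E₁ : ℝ}
    (hdecay : ∀ z : PhaseSpace N, E₁ ≤ (pureQuarticChain μ γ).hamiltonian N z →
      ∫⁻ y, ENNReal.ofReal (Real.exp (θ * (pureQuarticChain μ γ).hamiltonian N y))
          ∂((pureQuarticChain μ γ).transitionKernel N T_L T_R tstar z) ≤
        ENNReal.ofReal (Real.exp (θ * (pureQuarticChain μ γ).hamiltonian N z) / 2)) :
    ∃ (κ c : ℝ) (K : Set (PhaseSpace N)), 0 < κ ∧ κ < 1 ∧ 0 < c ∧ IsCompact K ∧
      ∀ z : PhaseSpace N,
        ∫⁻ y, ENNReal.ofReal (Real.exp (θ * (pureQuarticChain μ γ).hamiltonian N y))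
            ∂((pureQuarticChain μ γ).transitionKernel N T_L T_R tstar z) ≤
          ENNReal.ofReal (κ * Real.exp (θ * (pureQuarticChain μ γ).hamiltonian N z) +
            c * K.indicator 1 z) := by
  set H := (pureQuarticChain μ γ).hamiltonian N with hH
  set c := Real.exp (θ * γ * (T_L + T_R) * tstar) * Real.exp (θ * E₁) with hc
  have hcpos : 0 < c := by positivity
  refine ⟨1 / 2, c, {x | H x ≤ E₁}, by norm_num, by norm_num, hcpos,
    pureQuarticChain_isCompact_setOf_hamiltonian_le hμ γ N E₁, fun z => ?_⟩
  have hind : 0 ≤ ({x | H x ≤ E₁} : Set (PhaseSpace N)).indicator (1 : PhaseSpace N → ℝ) z :=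
    Set.indicator_nonneg (fun _ _ => zero_le_one) z
  by_cases hz : E₁ ≤ H z
  · refine (hdecay z hz).trans (ENNReal.ofReal_le_ofReal ?_)
    have : 0 ≤ c * ({x | H x ≤ E₁} : Set (PhaseSpace N)).indicator 1 z := mul_nonneg hcpos.le hind
    linarith
  · have hzK : z ∈ ({x | H x ≤ E₁} : Set (PhaseSpace N)) := le_of_lt (not_le.1 hz)
    rw [Set.indicator_of_mem hzK, Pi.one_apply, mul_one]
    refine (pureQuarticChain_lintegral_exp_mul_hamiltonian_transitionKernel_le hμ hγ.le N T_L T_R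
      hN hTL hTR.le hθ hθ' tstar z).trans (ENNReal.ofReal_le_ofReal ?_)
    have h1 : Real.exp (θ * H z) ≤ Real.exp (θ * E₁) :=
      Real.exp_le_exp.2 (mul_le_mul_of_nonneg_left (le_of_lt (not_le.1 hz)) hθ.le)
    have h2 : Real.exp (θ * γ * (T_L + T_R) * tstar) * Real.exp (θ * H z) ≤ c :=
      mul_le_mul_of_nonneg_left h1 (Real.exp_pos _).le
    have h3 : 0 ≤ 1 / 2 * Real.exp (θ * H z) := by positivity
    linarith

/-- **Reduction of the decay over `[0, t*]` to one window `w ≤ t*`** (in place of CEHR Cor. 5.4):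
if from every `z` with `H(z) ≥ E₁` some window `w ≤ t*` has `P_w e^{θH}(z) ≤ κ₀ e^{θH(z)}` and
`κ₀ e^{θγ(T_L+T_R)t*} ≤ 1/2`, then `P_{t*} e^{θH}(z) ≤ e^{θH(z)}/2` for `H(z) ≥ E₁`:
`P_{t*} = P_{t*-w} ∘ P_w` (Chapman–Kolmogorov) and `P_{t*-w} e^{θH} ≤ e^{θγ(T_L+T_R)(t*-w)} e^{θH}`
((3.4)). [cite: CuneoEckmannHairerReyBellet2018, Cor 5.4 and Rem 5.7] -/
theorem pureQuarticChain_transitionKernel_decay_of_window {θ : ℝ} (hθ : 0 < θ) (hθ' : θ < 1 / max T_L T_R) (tstar : ℝ≥0)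
    {E₁ κ₀ : ℝ} (hκ : κ₀ * Real.exp (θ * γ * (T_L + T_R) * tstar) ≤ 1 / 2)
    (hwin : ∀ z : PhaseSpace N, E₁ ≤ (pureQuarticChain μ γ).hamiltonian N z →
      ∃ w : ℝ≥0, w ≤ tstar ∧
        ∫⁻ y, ENNReal.ofReal (Real.exp (θ * (pureQuarticChain μ γ).hamiltonian N y))
            ∂((pureQuarticChain μ γ).transitionKernel N T_L T_R w z) ≤
          ENNReal.ofReal (κ₀ * Real.exp (θ * (pureQuarticChain μ γ).hamiltonian N z)))
    (z : PhaseSpace N) (hz : E₁ ≤ (pureQuarticChain μ γ).hamiltonian N z) :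
    ∫⁻ y, ENNReal.ofReal (Real.exp (θ * (pureQuarticChain μ γ).hamiltonian N y))
        ∂((pureQuarticChain μ γ).transitionKernel N T_L T_R tstar z) ≤
      ENNReal.ofReal (Real.exp (θ * (pureQuarticChain μ γ).hamiltonian N z) / 2) := by
  set P := pureQuarticChain μ γ with hP
  set H := P.hamiltonian N with hH
  set κ := P.transitionKernel N T_L T_R with hκ'
  obtain ⟨w, hw, hb⟩ := hwin z hz
  set s : ℝ≥0 := tstar - w with hs
  have hts : tstar = w + s := (add_tsub_cancel_of_le hw).symm
  have hsle : (s : ℝ) ≤ tstar := by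
    have : s ≤ tstar := tsub_le_self
    exact_mod_cast this
  have hVm : Measurable fun y : PhaseSpace N => ENNReal.ofReal (Real.exp (θ * H y)) :=
    ENNReal.measurable_ofReal.comp (Real.measurable_exp.comp
      (measurable_const.mul (pureQuarticChain_continuous_hamiltonian μ γ N).measurable))
  -- Chapman–Kolmogorov
  have e1 : ∫⁻ y, ENNReal.ofReal (Real.exp (θ * H y)) ∂(κ tstar z) =
      ∫⁻ y, ∫⁻ y', ENNReal.ofReal (Real.exp (θ * H y')) ∂(κ s y) ∂(κ w z) := by
    rw [hts, hκ', pureQuarticChain_transitionKernel_add hμ hγ.le N T_L T_R w s]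
    exact Kernel.lintegral_comp _ _ _ hVm
  -- (3.4) on the remaining time `s = t* - w`
  have e2 : ∀ y, ∫⁻ y', ENNReal.ofReal (Real.exp (θ * H y')) ∂(κ s y) ≤
      ENNReal.ofReal (Real.exp (θ * γ * (T_L + T_R) * tstar)) * ENNReal.ofReal (Real.exp (θ * H y)) := by
    intro y
    refine (pureQuarticChain_lintegral_exp_mul_hamiltonian_transitionKernel_le hμ hγ.le N T_L T_R
      hN hTL hTR.le hθ hθ' s y).trans ?_
    rw [← ENNReal.ofReal_mul (Real.exp_pos _).le]
    refine ENNReal.ofReal_le_ofReal (mul_le_mul_of_nonneg_right ?_ (Real.exp_pos _).le)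
    refine Real.exp_le_exp.2 (mul_le_mul_of_nonneg_left hsle ?_)
    have := hγ.le; have := hTL.le; have := hTR.le
    positivity
  calc ∫⁻ y, ENNReal.ofReal (Real.exp (θ * H y)) ∂(κ tstar z)
      = ∫⁻ y, ∫⁻ y', ENNReal.ofReal (Real.exp (θ * H y')) ∂(κ s y) ∂(κ w z) := e1
    _ ≤ ∫⁻ y, ENNReal.ofReal (Real.exp (θ * γ * (T_L + T_R) * tstar)) *
          ENNReal.ofReal (Real.exp (θ * H y)) ∂(κ w z) := lintegral_mono fun y => e2 y
    _ = ENNReal.ofReal (Real.exp (θ * γ * (T_L + T_R) * tstar)) *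
          ∫⁻ y, ENNReal.ofReal (Real.exp (θ * H y)) ∂(κ w z) := lintegral_const_mul _ hVm
    _ ≤ ENNReal.ofReal (Real.exp (θ * γ * (T_L + T_R) * tstar)) *
          ENNReal.ofReal (κ₀ * Real.exp (θ * H z)) := by gcongr
    _ = ENNReal.ofReal (κ₀ * Real.exp (θ * γ * (T_L + T_R) * tstar) * Real.exp (θ * H z)) := by
        rw [← ENNReal.ofReal_mul (Real.exp_pos _).le]
        ring_nf
    _ ≤ ENNReal.ofReal (Real.exp (θ * H z) / 2) := by
        refine ENNReal.ofReal_le_ofReal ?_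
        have h1 := mul_le_mul_of_nonneg_right hκ (Real.exp_pos (θ * H z)).le
        linarith

/-- **The window estimate from a pathwise energy drop** (in place of CEHR Lemma 5.5, which uses
Itô's formula and the Doléans-Dade supermartingale): if on the event
`{sup_{s≤w}|B¹_s| ≤ a, sup_{s≤w}|B²_s| ≤ a}` of the pair of Brownian motions the pathwise solution
started at `z` loses at least `D/θ` of energy by time `w`, then
`P_w e^{θH}(z) ≤ e^{θH(z)} (e^{-D} + e^{θγ(T_L+T_R)w} P(bad)^{1-1/p})` for any `p > 1` with
`pθ < 1/max(T_L,T_R)`: the expectation is split according to the event; on the bad event Hölder's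
inequality and the a-priori bound (3.4) at `pθ` (`(P_w e^{pθH}(z))^{1/p} ≤ e^{θγ(T_L+T_R)w} e^{θH(z)}`)
are used. [cite: CuneoEckmannHairerReyBellet2018, Lemma 5.5 and §3 eq. (3.4)] -/
theorem pureQuarticChain_transitionKernel_window_decay_of_pathwise {θ : ℝ} (hθ : 0 < θ) {p : ℝ} (hp : 1 < p)
    (hpθ : p * θ < 1 / max T_L T_R) (w : ℝ≥0) (a D : ℝ) (z : PhaseSpace N)
    (hgood : ∀ ω ∈ goodEvent a w,
      θ * (pureQuarticChain μ γ).hamiltonian N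
          ((pureQuarticChain μ γ).solMap N T_L T_R w z (pairPath ω)) ≤
        θ * (pureQuarticChain μ γ).hamiltonian N z - D) :
    ∫⁻ y, ENNReal.ofReal (Real.exp (θ * (pureQuarticChain μ γ).hamiltonian N y))
        ∂((pureQuarticChain μ γ).transitionKernel N T_L T_R w z) ≤
      ENNReal.ofReal (Real.exp (θ * (pureQuarticChain μ γ).hamiltonian N z)) *
        (ENNReal.ofReal (Real.exp (-D)) +
          ENNReal.ofReal (Real.exp (θ * γ * (T_L + T_R) * w)) *
            (wienerPair (goodEvent a w)ᶜ) ^ (1 - p⁻¹)) := by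
  set P := pureQuarticChain μ γ with hP
  set H := P.hamiltonian N with hH
  set κ := P.transitionKernel N T_L T_R with hκ'
  set Φ : WienerPair → PhaseSpace N := fun ω => P.solMap N T_L T_R w z (pairPath ω) with hΦ
  set G := goodEvent a w with hG
  have hGm : MeasurableSet G := measurableSet_goodEvent a w
  have hp0 : (0 : ℝ) < p := by linarith
  have hθp : 0 < p * θ := mul_pos hp0 hθ
  have hVm : ∀ θ' : ℝ, Measurable fun y : PhaseSpace N => ENNReal.ofReal (Real.exp (θ' * H y)) :=
    fun θ' => ENNReal.measurable_ofReal.comp (Real.measurable_exp.comp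
      (measurable_const.mul (pureQuarticChain_continuous_hamiltonian μ γ N).measurable))
  have hΦm : Measurable Φ :=
    pureQuarticChain_measurable_solMap_pairPath_right hμ hγ.le N T_L T_R w z
  set f : WienerPair → ℝ≥0∞ := fun ω => ENNReal.ofReal (Real.exp (θ * H (Φ ω))) with hf
  have hfm : Measurable f := (hVm θ).comp hΦm
  -- pathwise representation of `P_w e^{θH}(z)`
  have e0 : ∫⁻ y, ENNReal.ofReal (Real.exp (θ * H y)) ∂(κ w z) = ∫⁻ ω, f ω ∂wienerPair :=
    pureQuarticChain_lintegral_transitionKernel hμ hγ.le N T_L T_R w z (hVm θ)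
  -- the good event: the pathwise energy drop
  have e1 : ∫⁻ ω in G, f ω ∂wienerPair ≤
      ENNReal.ofReal (Real.exp (θ * H z)) * ENNReal.ofReal (Real.exp (-D)) := by
    calc ∫⁻ ω in G, f ω ∂wienerPair
        ≤ ∫⁻ _ in G, ENNReal.ofReal (Real.exp (θ * H z)) * ENNReal.ofReal (Real.exp (-D))
            ∂wienerPair := by
          refine setLIntegral_mono' hGm fun ω hω => ?_
          show ENNReal.ofReal (Real.exp (θ * H (Φ ω))) ≤ _
          rw [← ENNReal.ofReal_mul (Real.exp_pos _).le, ← Real.exp_add]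
          exact ENNReal.ofReal_le_ofReal (Real.exp_le_exp.2 (by linarith [hgood ω hω]))
      _ = ENNReal.ofReal (Real.exp (θ * H z)) * ENNReal.ofReal (Real.exp (-D)) * wienerPair G :=
          setLIntegral_const _ _
      _ ≤ ENNReal.ofReal (Real.exp (θ * H z)) * ENNReal.ofReal (Real.exp (-D)) * 1 := by
          gcongr
          exact prob_le_one
      _ = _ := mul_one _
  -- the bad event: Hölder with exponents `p`, `p/(p-1)` and (3.4) at `pθ`
  have e2 : ∫⁻ ω in Gᶜ, f ω ∂wienerPair ≤
      ENNReal.ofReal (Real.exp (θ * H z)) * (ENNReal.ofReal (Real.exp (θ * γ * (T_L + T_R) * w)) *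
        (wienerPair Gᶜ) ^ (1 - p⁻¹)) := by
    have hpq : p.HolderConjugate (Real.conjExponent p) := Real.HolderConjugate.conjExponent hp
    set g : WienerPair → ℝ≥0∞ := Gᶜ.indicator 1 with hg
    have hgm : Measurable g := measurable_one.indicator hGm.compl
    have e21 : ∫⁻ ω in Gᶜ, f ω ∂wienerPair = ∫⁻ ω, (f * g) ω ∂wienerPair := by
      rw [← lintegral_indicator hGm.compl]
      refine lintegral_congr fun ω => ?_
      by_cases hω : ω ∈ Gᶜ
      · rw [Set.indicator_of_mem hω, Pi.mul_apply, hg, Set.indicator_of_mem hω, Pi.one_apply, mul_one]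
      · rw [Set.indicator_of_notMem hω, Pi.mul_apply, hg, Set.indicator_of_notMem hω, mul_zero]
    have e22 := ENNReal.lintegral_mul_le_Lp_mul_Lq wienerPair hpq hfm.aemeasurable hgm.aemeasurable
    have e23 : ∫⁻ ω, f ω ^ p ∂wienerPair ≤
        ENNReal.ofReal (Real.exp (p * θ * γ * (T_L + T_R) * w) * Real.exp (p * θ * H z)) := by
      have h1 : ∀ ω, f ω ^ p = ENNReal.ofReal (Real.exp (p * θ * H (Φ ω))) := fun ω => by
        show ENNReal.ofReal (Real.exp (θ * H (Φ ω))) ^ p = _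
        rw [ENNReal.ofReal_rpow_of_pos (Real.exp_pos _), ← Real.exp_mul]
        congr 2
        ring
      simp_rw [h1]
      rw [← pureQuarticChain_lintegral_transitionKernel hμ hγ.le N T_L T_R w z (hVm (p * θ))]
      exact pureQuarticChain_lintegral_exp_mul_hamiltonian_transitionKernel_le hμ hγ.le N T_L T_R
        hN hTL hTR.le hθp hpθ w z
    have e24 : (∫⁻ ω, f ω ^ p ∂wienerPair) ^ (1 / p) ≤
        ENNReal.ofReal (Real.exp (θ * γ * (T_L + T_R) * w) * Real.exp (θ * H z)) := by
      refine (ENNReal.rpow_le_rpow e23 (by positivity)).trans (le_of_eq ?_)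
      have h2 : (Real.exp (p * θ * γ * (T_L + T_R) * w) * Real.exp (p * θ * H z)) ^ (1 / p) =
          Real.exp (θ * γ * (T_L + T_R) * w) * Real.exp (θ * H z) := by
        rw [← Real.exp_add, ← Real.exp_add, ← Real.exp_mul]
        congr 1
        field_simp
      rw [ENNReal.ofReal_rpow_of_nonneg (by positivity) (by positivity), h2]
    have e25 : ∫⁻ ω, g ω ^ Real.conjExponent p ∂wienerPair = wienerPair Gᶜ := by
      have hq : 0 < Real.conjExponent p := hpq.symm.pos
      have h1 : ∀ ω, g ω ^ Real.conjExponent p = g ω := fun ω => by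
        by_cases hω : ω ∈ Gᶜ
        · rw [hg, Set.indicator_of_mem hω, Pi.one_apply, ENNReal.one_rpow]
        · rw [hg, Set.indicator_of_notMem hω, ENNReal.zero_rpow_of_pos hq]
      simp_rw [h1, hg]
      exact lintegral_indicator_one hGm.compl
    have e26 : 1 / Real.conjExponent p = 1 - p⁻¹ := by
      simp only [Real.conjExponent]
      have : p - 1 ≠ 0 := by linarith
      field_simp
    calc ∫⁻ ω in Gᶜ, f ω ∂wienerPair = ∫⁻ ω, (f * g) ω ∂wienerPair := e21
      _ ≤ (∫⁻ ω, f ω ^ p ∂wienerPair) ^ (1 / p) *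
            (∫⁻ ω, g ω ^ Real.conjExponent p ∂wienerPair) ^ (1 / Real.conjExponent p) := e22
      _ ≤ ENNReal.ofReal (Real.exp (θ * γ * (T_L + T_R) * w) * Real.exp (θ * H z)) *
            (wienerPair Gᶜ) ^ (1 - p⁻¹) := by
          rw [e25, e26]
          gcongr
      _ = _ := by
          rw [ENNReal.ofReal_mul (Real.exp_pos _).le]
          ring
  rw [e0, ← lintegral_add_compl f hGm, mul_add]
  exact add_le_add e1 e2

end Assembly

/-! ### One window: from a pathwise dissipation bound to the decay of `P_w e^{θH}` -/

section Window

variable {μ γ : ℝ} {T_L T_R : ℝ}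
variable (hμ : 0 < μ) (hγ : 0 < γ) (hN : 0 < N) (hTL : 0 < T_L)
  (hTR : 0 < T_R)
include hμ hγ hN hTL hTR

set_option maxHeartbeats 1600000 in
/-- **The decay over one window from a pathwise dissipation bound.** At scale `K` (`H(z) ≤ 2K⁴`),
for a window `w ≤ min(1, t*)` on which every noise path of size `≤ √K` makes the smooth part
dissipate at least `Dis`, with the energy error of `LangevinChainEnergyScale.lean` at most `Dis/2`,
`θ Dis/2 ≥ log(2/κ₀)`, and `K` so large that the bad event `{sup |B| > √K/c}` is negligible:
`P_w e^{θH}(z) ≤ κ₀ e^{θH(z)}`. The good event is handled by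
`pureQuarticChain_transitionKernel_window_decay_of_pathwise` (`LangevinChainH2.lean`), the bad one by Hölder, (3.4) and
`BrownianSupTail.lean`. [cite: CuneoEckmannHairerReyBellet2018, Thm 5.1 (proof, p. 12)] -/
theorem pureQuarticChain_transitionKernel_window_decay_of_dissipation {θ : ℝ} (hθ : 0 < θ) {p : ℝ} (hp : 1 < p)
    (hpθ : p * θ < 1 / max T_L T_R) (tstar : ℝ≥0) {K wr Dis κ₀ : ℝ} (hK : 1 ≤ K) (hwr0 : 0 < wr)
    (hwr1 : wr ≤ 1) (hwrt : wr ≤ tstar) (hκ₀ : 0 < κ₀) {z : PhaseSpace N}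
    (hz2 : (pureQuarticChain μ γ).hamiltonian N z ≤ 2 * K ^ 4)
    (hAM : pinnedChainScaleA γ N * Real.sqrt K * wr ≤ K)
    (hdis : ∀ η : ℝ → Fin N → ℝ, Continuous η → (∀ s ∈ Icc 0 wr, ‖η s‖ ≤ Real.sqrt K) →
      Dis ≤ γ * ∫ s in (0 : ℝ)..wr, ∑ i, bathWeight N i *
        ((pureQuarticChain μ γ).chainFlow N z η s - ((0 : Fin N → ℝ), η s)).2 i ^ 2)
    (herr : wr * Real.sqrt K * ((pinnedChainScaleA γ N * pinnedChainScaleC 0 μ 0 γ N +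
        pinnedChainScaleB 0 μ 0 γ N) * K ^ 3) +
        N * Real.sqrt K * ((pinnedChainScaleC 0 μ 0 γ N + 1 / 2) * K ^ 2 + Real.sqrt K / 2) ≤ Dis / 2)
    (hD : Real.log (2 / κ₀) ≤ θ * Dis / 2)
    (hcs : 4 * (|Real.sqrt (2 * γ * T_L)| + |Real.sqrt (2 * γ * T_R)| + 1) ^ 2 ≤ K)
    (hbad : 16 * (|Real.sqrt (2 * γ * T_L)| + |Real.sqrt (2 * γ * T_R)| + 1) ^ 4 / K ≤
      (κ₀ / (2 * Real.exp (θ * γ * (T_L + T_R) * tstar))) ^ (1 - p⁻¹)⁻¹) :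
    ∃ w : ℝ≥0, w ≤ tstar ∧
      ∫⁻ y, ENNReal.ofReal (Real.exp (θ * (pureQuarticChain μ γ).hamiltonian N y))
          ∂((pureQuarticChain μ γ).transitionKernel N T_L T_R w z) ≤
        ENNReal.ofReal (κ₀ * Real.exp (θ * (pureQuarticChain μ γ).hamiltonian N z)) := by
  set P := pureQuarticChain μ γ with hP
  set H := P.hamiltonian N with hH
  set A := pinnedChainScaleA γ N with hA
  set c₁ := pinnedChainScaleC 0 μ 0 γ N with hc₁
  set B := pinnedChainScaleB 0 μ 0 γ N with hB
  set c_L := Real.sqrt (2 * γ * T_L) with hcL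
  set c_R := Real.sqrt (2 * γ * T_R) with hcR
  set cs := |c_L| + |c_R| + 1 with hcs'
  have hcs1 : 1 ≤ cs := by rw [hcs']; linarith [abs_nonneg c_L, abs_nonneg c_R]
  have hcs0 : 0 < cs := by linarith
  have hK0 : 0 < K := by linarith
  set M := Real.sqrt K with hM
  have hM1 : 1 ≤ M := by rw [hM, Real.le_sqrt (by norm_num) hK0.le]; simpa using hK
  have hM0 : 0 < M := by linarith
  have hMK : M ^ 2 = K := Real.sq_sqrt hK0.le
  set w : ℝ≥0 := ⟨wr, hwr0.le⟩ with hw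
  have hwc : ((w : ℝ≥0) : ℝ) = wr := rfl
  set a := M / cs with ha
  set C := θ * γ * (T_L + T_R) with hC
  have hC0 : 0 ≤ C := by rw [hC]; have := hTL.le; have := hTR.le; positivity
  set G := Real.exp (C * tstar) with hG
  set D := θ * Dis / 2 with hDdef
  refine ⟨w, by exact_mod_cast hwrt, ?_⟩
  -- the pathwise energy drop on the good event
  have hgood : ∀ ω ∈ goodEvent a w,
      θ * H (P.solMap N T_L T_R w z (pairPath ω)) ≤ θ * H z - D := by
    intro ω hω'
    set η := chainNoise N (Real.sqrt (2 * P.γ * T_L)) (Real.sqrt (2 * P.γ * T_R)) (pairPath ω) with hη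
    have hηc : Continuous η := continuous_chainNoise _ _ _
    have hsol : P.solMap N T_L T_R w z (pairPath ω) = P.chainFlow N z η wr := rfl
    have hMb : ∀ s ∈ Icc 0 wr, ‖η s‖ ≤ M := by
      intro s hs
      have h1 := norm_chainNoise_le_of_mem_goodEvent (N := N) (Real.sqrt (2 * P.γ * T_L))
        (Real.sqrt (2 * P.γ * T_R)) hω' (s := s) (by rw [hwc]; exact hs.2)
      have hγ' : P.γ = γ := rfl
      rw [hγ'] at h1
      refine h1.trans ?_
      rw [ha, ← hcL, ← hcR]
      rw [mul_div_assoc']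
      rw [div_le_iff₀ hcs0]
      nlinarith [abs_nonneg c_L, abs_nonneg c_R, hM0.le]
    have hAMT : A * M * wr ≤ K := hAM
    have hdrop := pureQuarticChain_hamiltonian_chainFlow_le_sub_dissipation hμ hγ.le N hK z hz2 hηc
      (T := wr) (M := M) hMb hAMT (t := wr) ⟨hwr0.le, le_rfl⟩
    have hdiss := hdis η hηc hMb
    rw [hsol]
    have hdrop' : H (P.chainFlow N z η wr) ≤ H z - γ * (∫ s in (0 : ℝ)..wr, ∑ i, bathWeight N i *
        (P.chainFlow N z η s - ((0 : Fin N → ℝ), η s)).2 i ^ 2) +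
        wr * M * ((A * c₁ + B) * K ^ 3) + N * M * ((c₁ + 1 / 2) * K ^ 2 + M / 2) := hdrop
    have : H (P.chainFlow N z η wr) ≤ H z - Dis / 2 := by linarith
    rw [hDdef]
    nlinarith [hθ]
  -- the probabilistic shell
  have hP3 := pureQuarticChain_transitionKernel_window_decay_of_pathwise hμ hγ hN hTL hTR hθ hp hpθ w a D z hgood
  refine hP3.trans ?_
  -- the three factors
  have hr0 : 0 < 1 - p⁻¹ := by
    have : p⁻¹ < 1 := inv_lt_one_of_one_lt₀ hp
    linarith
  have h1 : Real.exp (-D) ≤ κ₀ / 2 := by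
    have hD' : Real.log (2 / κ₀) ≤ D := by rw [hDdef]; linarith
    have := Real.exp_le_exp.2 (neg_le_neg hD')
    rw [Real.exp_neg (Real.log (2 / κ₀)), Real.exp_log (by positivity), inv_div] at this
    exact this
  have h2 : Real.exp (θ * γ * (T_L + T_R) * w) ≤ G := by
    rw [hG, hC]; refine Real.exp_le_exp.2 ?_
    rw [hwc]
    exact mul_le_mul_of_nonneg_left (by exact_mod_cast hwrt) hC0
  set y₀ := κ₀ / (2 * G) with hy₀
  have hy₀0 : 0 < y₀ := by positivity
  have hGpos : 0 < G := by rw [hG]; exact Real.exp_pos _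
  have hGy : G * y₀ = κ₀ / 2 := by
    rw [hy₀]; field_simp
  have h3 : (wienerPair (goodEvent a w)ᶜ) ^ (1 - p⁻¹) ≤ ENNReal.ofReal y₀ := by
    have hb := wienerPair_compl_goodEvent_le hK hcs1 w (by rw [hwc]; exact hwr1)
      (by rw [hwc]; nlinarith [sq_nonneg cs])
    have hb' : (wienerPair (goodEvent a w)ᶜ) ^ (1 - p⁻¹) ≤ (ENNReal.ofReal (16 * cs ^ 4 / K)) ^ (1 - p⁻¹) :=
      ENNReal.rpow_le_rpow hb hr0.le
    refine hb'.trans ?_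
    rw [ENNReal.ofReal_rpow_of_nonneg (by positivity) hr0.le]
    refine ENNReal.ofReal_le_ofReal ?_
    have hx : 16 * cs ^ 4 / K ≤ y₀ ^ (1 - p⁻¹)⁻¹ := hbad
    calc (16 * cs ^ 4 / K) ^ (1 - p⁻¹) ≤ (y₀ ^ (1 - p⁻¹)⁻¹) ^ (1 - p⁻¹) :=
          Real.rpow_le_rpow (by positivity) hx hr0.le
      _ = y₀ := Real.rpow_inv_rpow hy₀0.le hr0.ne'
  calc ENNReal.ofReal (Real.exp (θ * H z)) * (ENNReal.ofReal (Real.exp (-D)) +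
        ENNReal.ofReal (Real.exp (θ * γ * (T_L + T_R) * w)) * (wienerPair (goodEvent a w)ᶜ) ^ (1 - p⁻¹))
      ≤ ENNReal.ofReal (Real.exp (θ * H z)) * (ENNReal.ofReal (κ₀ / 2) + ENNReal.ofReal G * ENNReal.ofReal y₀) := by
        have h1' := ENNReal.ofReal_le_ofReal h1
        have h2' := ENNReal.ofReal_le_ofReal h2
        gcongr
    _ = ENNReal.ofReal (κ₀ * Real.exp (θ * H z)) := by
        rw [← ENNReal.ofReal_mul hGpos.le, ← ENNReal.ofReal_add (by positivity) (by positivity),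
          ← ENNReal.ofReal_mul (Real.exp_pos _).le, hGy]
        congr 1
        ring

end Window

/-! ### Theorem 5.1 / Remark 5.2 for the purely quartic chain -/

set_option maxHeartbeats 3200000 in
/-- **Cuneo–Eckmann–Hairer–Rey-Bellet 2018, Theorem 5.1 with Remark 5.2 (the Lyapunov condition H2
for `V = e^{θH}`) for the transition kernels of the purely quartic chain, PROVED** for all `μ, γ > 0`,
`N ≥ 1`, `T_L, T_R > 0`, `0 < θ < 1/max(T_L,T_R)`, `t* > 0`. Printed: "We fix `t_* > 0` and
`θ < 1/T_max` … Theorem 5.1. Under Conditions C1, C3, C4 and C5, there is a constant `C₁ > 0` such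
that for all `z₀` such that `H(z₀)` is large enough, `E_{z₀} e^{θH(z_{t*}) - θH(z₀)} ≤ e^{-C₁H(z₀)}`.
Remark 5.2. By the coercivity of `H`, the theorem above implies that there exist constants
`κ ∈ (0,1)` and `c > 0`, and a compact set `K` such that `E_z e^{θH(z_{t*})} ≤ κ e^{θH(z)} + c1_K(z)`."
The statement is that of Remark 5.2 for the constructed kernels `OscillatorChain.transitionKernel`
(`E_z` = the Lebesgue integral against `P_{t*}(z, ·)`; the exact twin, for `pureQuarticChain μ γ`, of
the named fact `CuneoEckmannHairerReyBellet2018_H2` of `LangevinChainDynkin.lean`, here a theorem and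
NOT re-vendored as a fact). The proof assembles the tree's Itô-free route re-instantiated for the
purely quartic chain: at energy `E = K⁴` every point is in the interaction regime
(`pureQuartic_limitChain_hamiltonian_ge_half`, exact homogeneity), the dissipation of the smooth part
over the window `1/K` (`pureQuarticChain_dissipation_ge_interaction`, `PureQuarticScaleCloseness.lean`)
beats the energy error of a noise path of size `√K` (`PureQuarticEnergyScale.lean`), the bad event
`{sup|B| > √K/c}` is `O(1/K)` and is absorbed by Hölder and (3.4), so `P_w e^{θH}(z) ≤ κ₀ e^{θH(z)}`
for `H(z)` large, whence Remark 5.2's form by Chapman–Kolmogorov, (3.4) and the compact sublevel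
sets of `H`. [cite: CuneoEckmannHairerReyBellet2018, Thm 5.1 and Rem 5.2] -/
theorem pureQuarticChain_transitionKernel_H2 {μ γ : ℝ} (hμ : 0 < μ) (hγ : 0 < γ) {N : ℕ} (hN : 0 < N)
    {T_L T_R : ℝ} (hTL : 0 < T_L) (hTR : 0 < T_R) {θ : ℝ} (hθ : 0 < θ)
    (hθ' : θ < 1 / max T_L T_R) (tstar : ℝ≥0) (htstar : 0 < tstar) :
    ∃ (κ c : ℝ) (K : Set (PhaseSpace N)), 0 < κ ∧ κ < 1 ∧ 0 < c ∧ IsCompact K ∧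
      ∀ z : PhaseSpace N,
        ∫⁻ y, ENNReal.ofReal (Real.exp (θ * (pureQuarticChain μ γ).hamiltonian N y))
            ∂((pureQuarticChain μ γ).transitionKernel N T_L T_R tstar z) ≤
          ENNReal.ofReal (κ * Real.exp (θ * (pureQuarticChain μ γ).hamiltonian N z) +
            c * K.indicator 1 z) := by
  -- the Hölder exponent `p` with `1 < p`, `pθ < 1/max(T_L,T_R)`
  have hTmax : 0 < max T_L T_R := lt_max_of_lt_left hTL
  have hθT0 : 0 < θ * max T_L T_R := mul_pos hθ hTmax
  have hθT : θ * max T_L T_R < 1 := by rwa [lt_div_iff₀ hTmax] at hθ'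
  obtain ⟨p, hpdef⟩ : ∃ p : ℝ, p = (1 / (θ * max T_L T_R) + 1) / 2 := ⟨_, rfl⟩
  have hp1 : 1 < p := by
    have h1 : 1 < 1 / (θ * max T_L T_R) := by rw [lt_div_iff₀ hθT0]; linarith only [hθT]
    rw [hpdef]; linarith only [h1]
  have hpθ : p * θ < 1 / max T_L T_R := by
    rw [hpdef, lt_div_iff₀ hTmax]
    have e : (1 / (θ * max T_L T_R) + 1) / 2 * θ * max T_L T_R = (1 + θ * max T_L T_R) / 2 := by
      field_simp
    rw [e]; linarith only [hθT]
  have hr0 : 0 < 1 - p⁻¹ := by have := inv_lt_one_of_one_lt₀ hp1; linarith only [this]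
  -- the constants of the energy estimates
  set A := pinnedChainScaleA γ N with hA
  have hA1 : 1 ≤ A := one_le_pinnedChainScaleA hγ.le N
  set c₁ := pinnedChainScaleC 0 μ 0 γ N with hc₁
  set B := pinnedChainScaleB 0 μ 0 γ N with hB
  have hc₁0 : 0 ≤ c₁ := pinnedChainScaleC_nonneg le_rfl hμ.le le_rfl hγ.le N
  have hB0 : 0 ≤ B := pinnedChainScaleB_nonneg le_rfl hμ.le le_rfl hγ.le N
  obtain ⟨CI, hCI⟩ : ∃ CI : ℝ, CI = (A * c₁ + B) + N * (c₁ + 1 / 2) + N / 2 := ⟨_, rfl⟩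
  have hCI0 : 0 ≤ CI := by rw [hCI]; positivity
  obtain ⟨cs, hcs⟩ : ∃ cs : ℝ, cs = |Real.sqrt (2 * γ * T_L)| + |Real.sqrt (2 * γ * T_R)| + 1 := ⟨_, rfl⟩
  have hcs1 : 1 ≤ cs := by
    rw [hcs]; linarith only [abs_nonneg (Real.sqrt (2 * γ * T_L)), abs_nonneg (Real.sqrt (2 * γ * T_R))]
  -- the decay factor `κ₀` and the thresholds it induces
  obtain ⟨G, hG⟩ : ∃ G : ℝ, G = Real.exp (θ * γ * (T_L + T_R) * tstar) := ⟨_, rfl⟩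
  have hG1 : 1 ≤ G := by
    rw [hG]; apply Real.one_le_exp
    have := hTL.le; have := hTR.le; positivity
  obtain ⟨κ₀, hκ₀⟩ : ∃ κ₀ : ℝ, κ₀ = 1 / (2 * G) := ⟨_, rfl⟩
  have hκ₀0 : 0 < κ₀ := by rw [hκ₀]; positivity
  have hκ₀1 : κ₀ ≤ 1 / 2 := by
    rw [hκ₀, div_le_div_iff₀ (by positivity) (by norm_num)]; linarith only [hG1]
  have hκG : κ₀ * Real.exp (θ * γ * (T_L + T_R) * tstar) ≤ 1 / 2 := by
    rw [← hG, hκ₀]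
    have hG0 : G ≠ 0 := by linarith only [hG1]
    have e : 1 / (2 * G) * G = 1 / 2 := by field_simp
    rw [e]
  obtain ⟨L₀, hL₀⟩ : ∃ L₀ : ℝ, L₀ = Real.log (2 / κ₀) := ⟨_, rfl⟩
  have hL₀0 : 0 ≤ L₀ := by
    rw [hL₀]; apply Real.log_nonneg; rw [le_div_iff₀ hκ₀0]; linarith only [hκ₀1]
  obtain ⟨y₀, hy₀⟩ : ∃ y₀ : ℝ, y₀ = κ₀ / (2 * G) := ⟨_, rfl⟩
  have hy₀0 : 0 < y₀ := by rw [hy₀]; positivity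
  obtain ⟨x₀, hx₀⟩ : ∃ x₀ : ℝ, x₀ = y₀ ^ (1 - p⁻¹)⁻¹ := ⟨_, rfl⟩
  have hx₀0 : 0 < x₀ := by rw [hx₀]; exact Real.rpow_pos_of_pos hy₀0 _
  -- the noise size `δ₀` of the dissipation lemma
  obtain ⟨δ₀, hδ₀⟩ : ∃ δ₀ : ℝ, δ₀ = 1 / (A + 1) := ⟨_, rfl⟩
  have hδ₀0 : 0 < δ₀ := by rw [hδ₀]; positivity
  have hδ₀1 : δ₀ ≤ 1 := by rw [hδ₀, div_le_one (by positivity)]; linarith only [hA1]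
  have hAδ : A * δ₀ * 1 ≤ 1 := by
    rw [hδ₀, mul_one, mul_one_div, div_le_one (by positivity)]; linarith only [hA1]
  -- the dissipation package (interaction regime; the only one for the purely quartic chain)
  obtain ⟨KI, εI, hKI1, hεI, hI⟩ := pureQuarticChain_dissipation_ge_interaction (μ := μ)
    (γ := γ) hμ hγ hN (Λ := 1) one_pos hδ₀0 hδ₀1 hAδ
  -- the scale threshold `K₅` and the energy threshold `E₁ = K₅⁴`
  obtain ⟨K₅, hK₅⟩ : ∃ K₅ : ℝ, K₅ = 1 + KI + (A + 1) ^ 2 + 1 / (tstar : ℝ) +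
      4 * cs ^ 2 + (2 * CI / εI) ^ 2 + 16 * cs ^ 4 / x₀ + 2 * L₀ / (θ * εI) := ⟨_, rfl⟩
  have hts0 : (0 : ℝ) < tstar := by exact_mod_cast htstar
  have hs1 : 0 ≤ KI := by linarith only [hKI1]
  have hs4 : 0 ≤ (A + 1) ^ 2 := by positivity
  have hs5 : 0 ≤ 1 / (tstar : ℝ) := by positivity
  have hs6 : 0 ≤ 4 * cs ^ 2 := by positivity
  have hs7 : 0 ≤ (2 * CI / εI) ^ 2 := by positivity
  have hs9 : 0 ≤ 16 * cs ^ 4 / x₀ := by positivity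
  have hs10 : 0 ≤ 2 * L₀ / (θ * εI) := by positivity
  obtain ⟨E₁, hE₁⟩ : ∃ E₁ : ℝ, E₁ = K₅ ^ 4 := ⟨_, rfl⟩
  refine pureQuarticChain_transitionKernel_H2_of_decay hμ hγ hN hTL hTR hθ hθ' tstar (E₁ := E₁)
    (pureQuarticChain_transitionKernel_decay_of_window hμ hγ hN hTL hTR hθ hθ' tstar (E₁ := E₁) (κ₀ := κ₀) hκG ?_)
  intro z hz
  -- the scale of `z`: `K = H(z)^{1/4} ≥ K₅`
  have hHz0 : 0 ≤ (pureQuarticChain μ γ).hamiltonian N z := pureQuarticChain_hamiltonian_nonneg hμ.le γ N z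
  obtain ⟨K, hKdef⟩ : ∃ K : ℝ, K = Real.sqrt (Real.sqrt ((pureQuarticChain μ γ).hamiltonian N z)) := ⟨_, rfl⟩
  have hK4 : K ^ 4 = (pureQuarticChain μ γ).hamiltonian N z := by
    rw [hKdef, show (4 : ℕ) = 2 * 2 from rfl, pow_mul, Real.sq_sqrt (Real.sqrt_nonneg _), Real.sq_sqrt hHz0]
  have hK₅1 : 1 ≤ K₅ := by rw [hK₅]; linarith only [hs1, hs4, hs5, hs6, hs7, hs9, hs10]
  have hK5 : K₅ ≤ K := by
    rw [hKdef, Real.le_sqrt (by linarith only [hK₅1]) (Real.sqrt_nonneg _), Real.le_sqrt (by positivity) hHz0]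
    calc (K₅ ^ 2) ^ 2 = E₁ := by rw [hE₁]; ring
      _ ≤ _ := hz
  have hthr : ∀ x : ℝ, x ≤ K₅ → x ≤ K := fun x hx => hx.trans hK5
  have hK1 : 1 ≤ K := hthr 1 (by rw [hK₅]; linarith only [hs1, hs4, hs5, hs6, hs7, hs9, hs10])
  have hK0 : 0 < K := by linarith only [hK1]
  have hKI : KI ≤ K := hthr _ (by rw [hK₅]; linarith only [hs1, hs4, hs5, hs6, hs7, hs9, hs10])
  have hKA2 : (A + 1) ^ 2 ≤ K := hthr _ (by rw [hK₅]; linarith only [hs1, hs4, hs5, hs6, hs7, hs9, hs10])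
  have hKt : 1 / (tstar : ℝ) ≤ K := hthr _ (by rw [hK₅]; linarith only [hs1, hs4, hs5, hs6, hs7, hs9, hs10])
  have hKcs : 4 * cs ^ 2 ≤ K := hthr _ (by rw [hK₅]; linarith only [hs1, hs4, hs5, hs6, hs7, hs9, hs10])
  have hKeI : (2 * CI / εI) ^ 2 ≤ K := hthr _ (by rw [hK₅]; linarith only [hs1, hs4, hs5, hs6, hs7, hs9, hs10])
  have hKx : 16 * cs ^ 4 / x₀ ≤ K := hthr _ (by rw [hK₅]; linarith only [hs1, hs4, hs5, hs6, hs7, hs9, hs10])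
  have hKLI : 2 * L₀ / (θ * εI) ≤ K := hthr _ (by rw [hK₅]; linarith only [hs1, hs4, hs5, hs6, hs7, hs9, hs10])
  have hz1 : K ^ 4 ≤ (pureQuarticChain μ γ).hamiltonian N z := hK4.le
  have hz2 : (pureQuarticChain μ γ).hamiltonian N z ≤ 2 * K ^ 4 := by rw [← hK4]; linarith only [pow_nonneg hHz0 1, sq_nonneg (K ^ 2)]
  -- `M = √K`
  obtain ⟨M, hM⟩ : ∃ M : ℝ, M = Real.sqrt K := ⟨_, rfl⟩
  have hMK : M * M = K := by rw [hM]; exact Real.mul_self_sqrt hK0.le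
  have hM1 : 1 ≤ M := by rw [hM, Real.le_sqrt (by norm_num) hK0.le]; simpa using hK1
  have hM0 : 0 < M := by linarith only [hM1]
  have hAM' : A + 1 ≤ M := by rw [hM, Real.le_sqrt (by positivity) hK0.le]; exact hKA2
  have hMδ : M ≤ δ₀ * K := by
    rw [hδ₀, one_div, le_inv_mul_iff₀ (by positivity : 0 < A + 1)]
    calc (A + 1) * M ≤ M * M := mul_le_mul_of_nonneg_right hAM' hM0.le
      _ = K := hMK
  have hAM : A * M ≤ K := by
    calc A * M ≤ M * M := mul_le_mul_of_nonneg_right (by linarith only [hAM']) hM0.le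
      _ = K := hMK
  have hbadK : 16 * cs ^ 4 / K ≤ x₀ := by
    rw [div_le_iff₀ hK0]
    have := hKx
    rw [div_le_iff₀ hx₀0] at this
    linarith only [this]
  have hKcs' : 4 * (|Real.sqrt (2 * γ * T_L)| + |Real.sqrt (2 * γ * T_R)| + 1) ^ 2 ≤ K := by
    rw [← hcs]; exact hKcs
  have hbadK' : 16 * (|Real.sqrt (2 * γ * T_L)| + |Real.sqrt (2 * γ * T_R)| + 1) ^ 4 / K ≤
      (κ₀ / (2 * Real.exp (θ * γ * (T_L + T_R) * tstar))) ^ (1 - p⁻¹)⁻¹ := by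
    rw [← hcs, ← hG, ← hy₀, ← hx₀]; exact hbadK
  have hMeI : 2 * CI ≤ εI * M := by
    have h1 : 2 * CI / εI ≤ M := by rw [hM, Real.le_sqrt (by positivity) hK0.le]; exact hKeI
    rw [div_le_iff₀ hεI] at h1
    linarith only [h1]
  have hK2 : K ≤ K ^ 2 := by nlinarith only [hK1]
  have hK3 : K ^ 2 ≤ K ^ 3 := by nlinarith only [hK1, hK2]
  have hKMK : K ≤ M * K ^ 2 := by nlinarith only [hM1, hK2, hK0]
  -- the interaction-regime window
  have hwinI : 1 / 2 ≤ (limitChain μ 1).hamiltonian N (rescale K z) →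
      ∃ w : ℝ≥0, w ≤ tstar ∧
        ∫⁻ y, ENNReal.ofReal (Real.exp (θ * (pureQuarticChain μ γ).hamiltonian N y))
            ∂((pureQuarticChain μ γ).transitionKernel N T_L T_R w z) ≤
          ENNReal.ofReal (κ₀ * Real.exp (θ * (pureQuarticChain μ γ).hamiltonian N z)) := by
    intro hreg
    have hwt : 1 / K ≤ (tstar : ℝ) := by rw [one_div_le hK0 hts0]; exact hKt
    refine pureQuarticChain_transitionKernel_window_decay_of_dissipation hμ hγ hN hTL hTR hθ hp1 hpθ tstar (K := K)
      (wr := 1 / K) (Dis := εI * K ^ 3) (κ₀ := κ₀) hK1 (by positivity)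
      (by rw [div_le_one hK0]; exact hK1) hwt hκ₀0 hz2 ?_ ?_ ?_ ?_ hKcs' hbadK'
    · -- `A √K (1/K) ≤ K`
      rw [← hA, ← hM]
      calc A * M * (1 / K) ≤ A * M * 1 := by
            refine mul_le_mul_of_nonneg_left ?_ (by positivity)
            rw [div_le_one hK0]; exact hK1
        _ ≤ K := by rw [mul_one]; exact hAM
    · intro η hη hηb
      exact hI K hKI z hz2 hreg η hη fun s hs => (hηb s hs).trans (by rw [← hM]; exact hMδ)
    · -- the energy error over the window `1/K` is `≤ CI √K K² ≤ εI K³/2`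
      rw [← hA, ← hc₁, ← hB, ← hM]
      have e1 : 1 / K * M * ((A * c₁ + B) * K ^ 3) = M * (A * c₁ + B) * K ^ 2 := by
        field_simp
      have e2 : N * M * ((c₁ + 1 / 2) * K ^ 2 + M / 2) = N * M * (c₁ + 1 / 2) * K ^ 2 + N * K / 2 := by
        rw [mul_add, show (N : ℝ) * M * (M / 2) = N * (M * M) / 2 by ring, hMK]; ring
      rw [e1, e2]
      have h3 : N * K / 2 ≤ N / 2 * M * K ^ 2 := by
        have := mul_le_mul_of_nonneg_left hKMK (by positivity : (0 : ℝ) ≤ N / 2)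
        linarith only [this]
      have h4 : M * (A * c₁ + B) * K ^ 2 + N * M * (c₁ + 1 / 2) * K ^ 2 + N / 2 * M * K ^ 2 = CI * M * K ^ 2 := by
        rw [hCI]; ring
      have h5 : CI * M * K ^ 2 ≤ εI * K ^ 3 / 2 := by
        have h6 : CI * M ≤ εI * (M * M) / 2 := by nlinarith only [hMeI, hM0]
        rw [hMK] at h6
        have h7 := mul_le_mul_of_nonneg_right h6 (sq_nonneg K)
        have e : εI * K / 2 * K ^ 2 = εI * K ^ 3 / 2 := by ring
        linarith only [h7, e]
      linarith only [h3, h4, h5]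
    · -- `log(2/κ₀) ≤ θ εI K³/2`
      have h1 : 2 * L₀ ≤ θ * εI * K := by
        have := hKLI
        rw [div_le_iff₀ (by positivity)] at this
        linarith only [this]
      have h2 : K ≤ K ^ 3 := hK2.trans hK3
      have h3 := mul_le_mul_of_nonneg_left h2 (by positivity : 0 ≤ θ * εI)
      rw [← hL₀]
      linarith only [h1, h3]
  exact hwinI (pureQuartic_limitChain_hamiltonian_ge_half μ γ hK0 N hz1)

/-! ## Part 2: transport to the model-free kernels `langevinKernel` -/

section Holds

variable {μ γ : ℝ} (hμ : 0 < μ) (hγ : 0 < γ) {N : ℕ} (hN : 0 < N) {T_L T_R : ℝ} (hL : 0 < T_L)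
  (hR : 0 < T_R)
include hμ hγ hN hL hR

/-- **H2 for the kernels of the transition semigroup `S`** (`OscillatorChain.langevinKernel`,
model-free pipeline): Part 1 transported along
`pureQuarticChain_langevinKernel_eq_transitionKernel`. [cite: CuneoEckmannHairerReyBellet2018, Thm 5.1 and Rem 5.2] -/
theorem pureQuarticChain_langevinKernel_H2 {θ : ℝ} (hθ : 0 < θ) (hθ' : θ < 1 / max T_L T_R)
    (tstar : ℝ≥0) (htstar : 0 < tstar) :
    ∃ (κ c : ℝ) (K : Set (PhaseSpace N)), 0 < κ ∧ κ < 1 ∧ 0 < c ∧ IsCompact K ∧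
      ∀ z : PhaseSpace N,
        ∫⁻ y, ENNReal.ofReal (Real.exp (θ * (pureQuarticChain μ γ).hamiltonian N y))
            ∂((pureQuarticChain μ γ).langevinKernel N T_L T_R tstar z) ≤
          ENNReal.ofReal (κ * Real.exp (θ * (pureQuarticChain μ γ).hamiltonian N z) +
            c * K.indicator 1 z) := by
  rw [pureQuarticChain_langevinKernel_eq_transitionKernel hμ hγ.le N T_L T_R tstar]
  exact pureQuarticChain_transitionKernel_H2 hμ hγ hN hL hR hθ hθ' tstar htstar

end Holds

end Literature.MathematicalPhysics.KineticTheory.HeatConduction
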